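import Mathlib
import Summits.ResolutionOfSingularities.ResolutionOfSingularities.Theorems.HomologicalConductorPersistenceKC3LocalModel
import Summits.ResolutionOfSingularities.ResolutionOfSingularities.Theorems.HomologicalConductorPersistenceKC3Tower
import HarnessLib

/-!
# Crux `Persistence` (stmt-ResolutionOfSingularities-16484) — w44b K-C3, K2c (c1): THE ALGEBRAIC LOCAL MODEL OF `T₀`
# `loc O B ≅ k[X]_𝔪 ⧸ J·k[X]_𝔪` for a polynomially parametrised subalgebra `B = k[g₁,…,gₙ] ⊆ K` centred at the origin

Route `ResolutionOfSingularities/HomologicalConductor`, chain W4.4b (cell `res-hironaka`), crux `Persistence`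
(stmt-ResolutionOfSingularities-16484), KILL CANDIDATE K-C3, KC3 SPELLING v1.1. The route's towers live INSIDE a field `K`
(`NoZeno.Birth.loc O B = B` localised at the centre of the valuation ring `O`); the K-C3 kernel files live on the abstract local
hypersurface ring `k[x,y,z,t]_𝔪 ⧸ (xy − z³ − t⁴)`. This file is the bridge, in the generality every K-C3 stage needs:

**`exists_locModelEquiv`** — for a field `K ⊇ k`, a point `g : Fin n → K`, the evaluation `φ = aeval g : k[X₁..Xₙ] → K` with
kernel `J`, and a valuation ring `O ∋ k` CENTRED AT THE ORIGIN of `B := range φ` (`O.valuation (g i) < 1` for all `i`), there is a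
ring isomorphism `e : ↥(loc O B) ≃+* k[X]_𝔪 ⧸ J·k[X]_𝔪` (`𝔪 = originIdeal k n`) with `e ⟨φ p, _⟩ = (p/1)‾` for every polynomial
`p`. Mechanism: a polynomial with non-zero constant term has value `1` at the centre (`valuation_aeval_eq_one`), one without has
value `< 1` (`valuation_aeval_lt_one`); so `Φ := IsLocalization.lift φ : k[X]_𝔪 → K` is defined, has range EXACTLY `loc O B`
(closed form `PersistenceKC3Tower.mem_loc_iff`, res-D-pv-043) and kernel `J·k[X]_𝔪`.

**K-C3 instances** (`g = (x, (z³+t⁴)x⁻¹, z, t)`, `J = (X 0 * X 1 − X 2 ^ 3 − X 3 ^ 4)` by `ker_aeval_kc3`, p-file K2c (c0)):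
`exists_kc3LocModelEquiv` (the route's `T₀ = loc O A` IS the §6 model `OriginLocalization k 4 ⧸ (f)`). The two corollaries the K5
glue consumes at the route's LITERAL `T₀` (`ca (loc O A) ⊆ I·(loc O A)` in res-D-pv-043's `hca` shape, and `x ∈ ca (loc O A)`) are
the sibling file `…KC3LocalModelCa.lean`.
res-type-010 (K2c (c0)+(c1), OFFER → TAKING-UNLESS-OBJECTED 2026-08-27T12:17:48Z; plan-1 «K5 glue (010)»). OURS; nothing here is a
statement of the manuscript under review (Hironaka 2017); AI-written, weaker than expert review.
Filed `--supports stmt-ResolutionOfSingularities-16484 --as helper`.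
-/

noncomputable section

-- single-problem summit: the doubled namespace component `ResolutionOfSingularities` is forced
set_option linter.dupNamespace false

namespace Summit.ResolutionOfSingularities.ResolutionOfSingularities.Theorems.HomologicalConductor.KC3Upper

open MvPolynomial
open Literature.RingTheory.CohomologyAnnihilator
open Literature.AlgebraicGeometry.Resolution
open Summit.ResolutionOfSingularities.ResolutionOfSingularities.Theorems.NoZeno.Birth
open Summit.ResolutionOfSingularities.ResolutionOfSingularities.Theorems.HomologicalConductor.PersistenceKC3Tower

/-! ## §1 Values at the centre -/

section Values

variable {k K : Type} [Field k] [Field K] [Algebra k K] {n : ℕ} (g : Fin n → K) (O : ValuationSubring K)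

/-- If `k ⊆ O` and every `g i` lies in the maximal ideal of `O`, then `φ p − p(0)` lies in the maximal ideal for every
polynomial `p` (`φ = aeval g`): `O.valuation (φ p − p(0)) < 1`. [folklore] -/
theorem valuation_aeval_sub_constantCoeff_lt_one (hk : ∀ c : k, algebraMap k K c ∈ O) (hg : ∀ i, O.valuation (g i) < 1)
    (p : MvPolynomial (Fin n) k) :
    O.valuation (MvPolynomial.aeval g p - algebraMap k K (constantCoeff p)) < 1 := by
  induction p using MvPolynomial.induction_on with
  | C a => simp
  | add p q hp hq =>
    have : MvPolynomial.aeval g (p + q) - algebraMap k K (constantCoeff (p + q)) =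
        (MvPolynomial.aeval g p - algebraMap k K (constantCoeff p)) +
          (MvPolynomial.aeval g q - algebraMap k K (constantCoeff q)) := by
      simp only [map_add]; ring
    rw [this]
    exact Valuation.map_add_lt _ hp hq
  | mul_X p i hp =>
    have hp1 : O.valuation (MvPolynomial.aeval g p) ≤ 1 := by
      have : MvPolynomial.aeval g p = (MvPolynomial.aeval g p - algebraMap k K (constantCoeff p)) +
          algebraMap k K (constantCoeff p) := by ring
      rw [this]
      exact Valuation.map_add_le _ hp.le ((O.valuation_le_one_iff _).mpr (hk _))
    simp only [map_mul, MvPolynomial.aeval_X, MvPolynomial.constantCoeff_X, mul_zero, map_zero, sub_zero]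
    calc O.valuation (MvPolynomial.aeval g p) * O.valuation (g i)
        ≤ 1 * O.valuation (g i) := by gcongr
      _ = O.valuation (g i) := one_mul _
      _ < 1 := hg i

/-- **Value at the centre, unit case**: `p(0) ≠ 0 ⇒ O.valuation (φ p) = 1`. [folklore] -/
theorem valuation_aeval_eq_one (hk : ∀ c : k, algebraMap k K c ∈ O) (hg : ∀ i, O.valuation (g i) < 1)
    {p : MvPolynomial (Fin n) k} (hp : constantCoeff p ≠ 0) : O.valuation (MvPolynomial.aeval g p) = 1 := by
  have hc : O.valuation (algebraMap k K (constantCoeff p)) = 1 := by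
    apply le_antisymm ((O.valuation_le_one_iff _).mpr (hk _))
    have hinv : O.valuation ((algebraMap k K (constantCoeff p))⁻¹) ≤ 1 := by
      rw [← map_inv₀]; exact (O.valuation_le_one_iff _).mpr (hk _)
    have hne : O.valuation (algebraMap k K (constantCoeff p)) ≠ 0 := by
      rw [Ne, Valuation.zero_iff]; exact (map_ne_zero _).mpr hp
    rw [map_inv₀] at hinv
    exact (inv_le_one₀ (zero_lt_iff.mpr hne)).mp hinv
  have h := valuation_aeval_sub_constantCoeff_lt_one g O hk hg p
  have hlt : O.valuation (MvPolynomial.aeval g p - algebraMap k K (constantCoeff p)) <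
      O.valuation (algebraMap k K (constantCoeff p)) := by rw [hc]; exact h
  have : MvPolynomial.aeval g p = algebraMap k K (constantCoeff p) +
      (MvPolynomial.aeval g p - algebraMap k K (constantCoeff p)) := by ring
  rw [this, Valuation.map_add_eq_of_lt_left _ hlt, hc]

/-- **Value at the centre, non-unit case**: `p(0) = 0 ⇒ O.valuation (φ p) < 1`. [folklore] -/
theorem valuation_aeval_lt_one (hk : ∀ c : k, algebraMap k K c ∈ O) (hg : ∀ i, O.valuation (g i) < 1)
    {p : MvPolynomial (Fin n) k} (hp : constantCoeff p = 0) : O.valuation (MvPolynomial.aeval g p) < 1 := by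
  have h := valuation_aeval_sub_constantCoeff_lt_one g O hk hg p
  rwa [hp, map_zero, sub_zero] at h

/-- `φ p ∈ O` for every polynomial `p`. [folklore] -/
theorem aeval_mem_valuationSubring (hk : ∀ c : k, algebraMap k K c ∈ O) (hg : ∀ i, O.valuation (g i) < 1)
    (p : MvPolynomial (Fin n) k) : MvPolynomial.aeval g p ∈ O := by
  rw [← O.valuation_le_one_iff]
  by_cases hp : constantCoeff p = 0
  · exact (valuation_aeval_lt_one g O hk hg hp).le
  · exact (valuation_aeval_eq_one g O hk hg hp).le

/-- `p(0) ≠ 0 ⇒ (φ p)⁻¹ ∈ O` (and `φ p ≠ 0`). [folklore] -/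
theorem inv_aeval_mem_valuationSubring (hk : ∀ c : k, algebraMap k K c ∈ O) (hg : ∀ i, O.valuation (g i) < 1)
    {p : MvPolynomial (Fin n) k} (hp : constantCoeff p ≠ 0) :
    MvPolynomial.aeval g p ≠ 0 ∧ (MvPolynomial.aeval g p)⁻¹ ∈ O := by
  have h1 := valuation_aeval_eq_one g O hk hg hp
  refine ⟨fun h0 => ?_, ?_⟩
  · rw [h0, map_zero] at h1; exact zero_ne_one h1
  · rw [← O.valuation_le_one_iff, map_inv₀, h1, inv_one]

end Values

/-! ## §2 The algebraic local model of `loc O (range φ)` -/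

section Model

variable {k K : Type} [Field k] [Field K] [Algebra k K] {n : ℕ} (g : Fin n → K) (O : ValuationSubring K)

/-- **THE ALGEBRAIC LOCAL MODEL (OURS · w44b K2c (c1)).** `K ⊇ k` fields, `g : Fin n → K`, `φ = aeval g`, `B = range φ ⊆ K`,
`J = ker φ`, `O` a valuation ring of `K` with `k ⊆ O` and `O.valuation (g i) < 1` for all `i` (centre of `O` on `B` = the origin).
Then there is a ring isomorphism **`e : ↥(loc O B) ≃+* k[X]_𝔪 ⧸ J·k[X]_𝔪`** (`𝔪 = originIdeal k n`, Mathlib's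
`Localization.AtPrime`) with **`e ⟨φ p, _⟩ = (algebraMap p)‾`** for every polynomial `p`. [folklore] -/
theorem exists_locModelEquiv (hk : ∀ c : k, algebraMap k K c ∈ O) (hg : ∀ i, O.valuation (g i) < 1) :
    ∃ e : ↥(loc O (MvPolynomial.aeval (R := k) g).range) ≃+*
        (Localization.AtPrime (originIdeal k n) ⧸
          (RingHom.ker (MvPolynomial.aeval (R := k) g).toRingHom).map
            (algebraMap (MvPolynomial (Fin n) k) (Localization.AtPrime (originIdeal k n)))),
      ∀ (p : MvPolynomial (Fin n) k) (hp : MvPolynomial.aeval g p ∈ loc O (MvPolynomial.aeval (R := k) g).range),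
        e ⟨MvPolynomial.aeval g p, hp⟩ =
          Ideal.Quotient.mk _ (algebraMap (MvPolynomial (Fin n) k) (Localization.AtPrime (originIdeal k n)) p) := by
  let φ : MvPolynomial (Fin n) k →+* K := (MvPolynomial.aeval (R := k) g).toRingHom
  set S := Localization.AtPrime (originIdeal k n)
  have hφp : ∀ p, φ p = MvPolynomial.aeval g p := fun p => rfl
  -- units: `q ∉ 𝔪 ⇒ φ q ∈ Kˣ`
  have hunit : ∀ q : (originIdeal k n).primeCompl, IsUnit (φ q) := fun q => by
    rw [hφp]
    have hq : constantCoeff (q : MvPolynomial (Fin n) k) ≠ 0 := by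
      have h := q.2; rwa [Ideal.mem_primeCompl_iff, mem_originIdeal_iff] at h
    exact isUnit_iff_ne_zero.mpr (inv_aeval_mem_valuationSubring g O hk hg hq).1
  let Φ : S →+* K := IsLocalization.lift (M := (originIdeal k n).primeCompl) (S := S) hunit
  have hΦa : ∀ p, Φ (algebraMap _ S p) = φ p := fun p => IsLocalization.lift_eq hunit p
  have hΦmk : ∀ (p : MvPolynomial (Fin n) k) (q : (originIdeal k n).primeCompl),
      Φ (IsLocalization.mk' S p q) = φ p * (φ q)⁻¹ := fun p q => by
    rw [IsLocalization.lift_mk'_spec, mul_comm, inv_mul_cancel_right₀ (hunit q).ne_zero]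
  -- range `Φ = loc O B`
  have hrange : ∀ w : S, Φ w ∈ loc O (MvPolynomial.aeval (R := k) g).range := fun w => by
    obtain ⟨p, q, rfl⟩ := IsLocalization.exists_mk'_eq (originIdeal k n).primeCompl w
    rw [hΦmk, mem_loc_iff]
    have hq : constantCoeff (q : MvPolynomial (Fin n) k) ≠ 0 := by
      have h := q.2; rwa [Ideal.mem_primeCompl_iff, mem_originIdeal_iff] at h
    exact ⟨φ p, ⟨p, rfl⟩, φ q, ⟨q, rfl⟩, (inv_aeval_mem_valuationSubring g O hk hg hq).2, rfl⟩
  have hsurj : ∀ w ∈ loc O (MvPolynomial.aeval (R := k) g).range, ∃ s : S, Φ s = w := fun w hw => by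
    rw [mem_loc_iff] at hw
    obtain ⟨a, ha, s, hs, hsO, rfl⟩ := hw
    rw [AlgHom.mem_range] at ha hs
    obtain ⟨p, rfl⟩ := ha
    obtain ⟨q, rfl⟩ := hs
    by_cases hs0 : (MvPolynomial.aeval (R := k) g) q = 0
    · exact ⟨0, by rw [map_zero, hs0, inv_zero, mul_zero]⟩
    have hq : constantCoeff q ≠ 0 := by
      intro hq0
      have hlt := valuation_aeval_lt_one g O hk hg hq0
      have hge : 1 ≤ O.valuation (MvPolynomial.aeval g q) := by
        have h := (O.valuation_le_one_iff _).mpr hsO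
        rw [map_inv₀] at h
        exact (inv_le_one₀ (zero_lt_iff.mpr (by rw [Ne, Valuation.zero_iff]; exact hs0))).mp h
      exact absurd hlt (not_lt.mpr hge)
    refine ⟨IsLocalization.mk' S p ⟨q, ?_⟩, by rw [hΦmk]; rfl⟩
    rwa [Ideal.mem_primeCompl_iff, mem_originIdeal_iff]
  -- kernel `Φ = J·S`
  have hker : RingHom.ker Φ = (RingHom.ker (MvPolynomial.aeval (R := k) g).toRingHom).map (algebraMap _ S) := by
    apply le_antisymm
    · intro w hw
      obtain ⟨p, q, rfl⟩ := IsLocalization.exists_mk'_eq (originIdeal k n).primeCompl w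
      rw [RingHom.mem_ker, hΦmk, mul_eq_zero, inv_eq_zero] at hw
      have hp : p ∈ RingHom.ker (MvPolynomial.aeval (R := k) g).toRingHom := by
        rcases hw with h | h
        · exact h
        · exact absurd h (hunit q).ne_zero
      rw [IsLocalization.mk'_eq_mul_mk'_one]
      exact Ideal.mul_mem_right _ _ (Ideal.mem_map_of_mem _ hp)
    · rw [Ideal.map_le_iff_le_comap]
      intro p hp
      rw [Ideal.mem_comap, RingHom.mem_ker, hΦa]
      exact hp
  -- the induced map on the quotient, into the subalgebra
  let Φ' : S →+* ↥(loc O (MvPolynomial.aeval (R := k) g).range) :=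
    Φ.codRestrict (loc O (MvPolynomial.aeval (R := k) g).range).toSubring hrange
  have hΦ'J : ∀ a ∈ (RingHom.ker (MvPolynomial.aeval (R := k) g).toRingHom).map (algebraMap _ S), Φ' a = 0 :=
      fun a ha => by
    apply Subtype.ext
    change Φ a = 0
    rw [← RingHom.mem_ker, hker]
    exact ha
  let ψ : S ⧸ (RingHom.ker (MvPolynomial.aeval (R := k) g).toRingHom).map (algebraMap _ S) →+*
      ↥(loc O (MvPolynomial.aeval (R := k) g).range) := Ideal.Quotient.lift _ Φ' hΦ'J
  have hψinj : Function.Injective ψ := by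
    refine RingHom.lift_injective_of_ker_le_ideal _ hΦ'J fun a ha => ?_
    rw [RingHom.mem_ker] at ha
    have : Φ a = 0 := congrArg Subtype.val ha
    rw [← hker, RingHom.mem_ker]
    exact this
  have hψsurj : Function.Surjective ψ := fun w => by
    obtain ⟨s, hs⟩ := hsurj w.1 w.2
    exact ⟨Ideal.Quotient.mk _ s, Subtype.ext (by rw [Ideal.Quotient.lift_mk]; exact hs)⟩
  refine ⟨(RingEquiv.ofBijective ψ ⟨hψinj, hψsurj⟩).symm, fun p hp => ?_⟩
  rw [RingEquiv.symm_apply_eq, RingEquiv.ofBijective_apply, Ideal.Quotient.lift_mk]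
  exact Subtype.ext (hΦa p).symm

end Model

/-! ## §3 The K-C3 instance: the route's `T₀ = loc O A` IS the §6 model `k[x,y,z,t]_𝔪 ⧸ (xy − z³ − t⁴)` -/

section KC3

variable (k K : Type) [Field k] [Field K] [Algebra (MvPolynomial (Fin 3) k) K] [IsFractionRing (MvPolynomial (Fin 3) k) K]
  [Algebra k K] [IsScalarTower k (MvPolynomial (Fin 3) k) K]

/-- **K2c (c1) at the K-C3 datum (OURS · w44b).** KC3 SPELLING v1.1: `x, z, t` = the images of `X 0, X 1, X 2 ∈ k[x,z,t]` in a
fraction field `K`, `y = (z³+t⁴)·x⁻¹`, `A = Algebra.adjoin k {x, z, t, y}`; `O` any valuation ring of `K` containing `k` with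
`x, y, z, t` in its maximal ideal (e.g. 084's `monomialValuationRing k (kc3Weight N) K`). Then the route's
**`T₀ = loc O A` is ring-isomorphic to `k[X₀..X₃]_𝔪 ⧸ (X 0 * X 1 − X 2 ^ 3 − X 3 ^ 4)`** (`𝔪 = originIdeal k 4`, the model of
`…KC3UpperLocal`), by an isomorphism sending (the class of) every polynomial expression `p(x, y, z, t)` to `(p/1)‾`. [folklore] -/
theorem exists_kc3LocModelEquiv (O : ValuationSubring K) (hk : ∀ c : k, algebraMap k K c ∈ O)
    (hx : O.valuation (algebraMap (MvPolynomial (Fin 3) k) K (X 0)) < 1)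
    (hy : O.valuation ((algebraMap (MvPolynomial (Fin 3) k) K (X 1) ^ 3 + algebraMap (MvPolynomial (Fin 3) k) K (X 2) ^ 4) *
      (algebraMap (MvPolynomial (Fin 3) k) K (X 0))⁻¹) < 1)
    (hz : O.valuation (algebraMap (MvPolynomial (Fin 3) k) K (X 1)) < 1)
    (ht : O.valuation (algebraMap (MvPolynomial (Fin 3) k) K (X 2)) < 1) :
    ∃ e : ↥(loc O (Algebra.adjoin k ({algebraMap (MvPolynomial (Fin 3) k) K (X 0), algebraMap (MvPolynomial (Fin 3) k) K (X 1),
        algebraMap (MvPolynomial (Fin 3) k) K (X 2),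
        (algebraMap (MvPolynomial (Fin 3) k) K (X 1) ^ 3 + algebraMap (MvPolynomial (Fin 3) k) K (X 2) ^ 4) *
          (algebraMap (MvPolynomial (Fin 3) k) K (X 0))⁻¹} : Set K))) ≃+*
        (Localization.AtPrime (originIdeal k 4) ⧸ Ideal.span {algebraMap (MvPolynomial (Fin 4) k)
          (Localization.AtPrime (originIdeal k 4)) (X 0 * X 1 - X 2 ^ 3 - X 3 ^ 4)}),
      ∀ (p : MvPolynomial (Fin 4) k)
        (hp : MvPolynomial.aeval (R := k)
          (![algebraMap (MvPolynomial (Fin 3) k) K (X 0),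
            (algebraMap (MvPolynomial (Fin 3) k) K (X 1) ^ 3 + algebraMap (MvPolynomial (Fin 3) k) K (X 2) ^ 4) *
              (algebraMap (MvPolynomial (Fin 3) k) K (X 0))⁻¹,
            algebraMap (MvPolynomial (Fin 3) k) K (X 1), algebraMap (MvPolynomial (Fin 3) k) K (X 2)] : Fin 4 → K) p ∈
          loc O (Algebra.adjoin k ({algebraMap (MvPolynomial (Fin 3) k) K (X 0), algebraMap (MvPolynomial (Fin 3) k) K (X 1),
            algebraMap (MvPolynomial (Fin 3) k) K (X 2),
            (algebraMap (MvPolynomial (Fin 3) k) K (X 1) ^ 3 + algebraMap (MvPolynomial (Fin 3) k) K (X 2) ^ 4) *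
              (algebraMap (MvPolynomial (Fin 3) k) K (X 0))⁻¹} : Set K))),
        e ⟨_, hp⟩ = Ideal.Quotient.mk _
          (algebraMap (MvPolynomial (Fin 4) k) (Localization.AtPrime (originIdeal k 4)) p) := by
  set g : Fin 4 → K := ![algebraMap (MvPolynomial (Fin 3) k) K (X 0),
      (algebraMap (MvPolynomial (Fin 3) k) K (X 1) ^ 3 + algebraMap (MvPolynomial (Fin 3) k) K (X 2) ^ 4) *
        (algebraMap (MvPolynomial (Fin 3) k) K (X 0))⁻¹,
      algebraMap (MvPolynomial (Fin 3) k) K (X 1), algebraMap (MvPolynomial (Fin 3) k) K (X 2)] with hgdef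
  set S := Localization.AtPrime (originIdeal k 4)
  have hg : ∀ i, O.valuation (g i) < 1 := by
    intro i; fin_cases i
    · exact hx
    · exact hy
    · exact hz
    · exact ht
  obtain ⟨e, he⟩ := exists_locModelEquiv g O hk hg
  have hR := range_aeval_kc3 k K
  have hJ : (RingHom.ker (MvPolynomial.aeval (R := k) g).toRingHom).map (algebraMap (MvPolynomial (Fin 4) k) S) =
      Ideal.span {algebraMap (MvPolynomial (Fin 4) k) S (X 0 * X 1 - X 2 ^ 3 - X 3 ^ 4)} := by
    rw [hgdef, ker_aeval_kc3 k K, Ideal.map_span, Set.image_singleton]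
  have hL : loc O (MvPolynomial.aeval (R := k) g).range =
      loc O (Algebra.adjoin k ({algebraMap (MvPolynomial (Fin 3) k) K (X 0), algebraMap (MvPolynomial (Fin 3) k) K (X 1),
        algebraMap (MvPolynomial (Fin 3) k) K (X 2),
        (algebraMap (MvPolynomial (Fin 3) k) K (X 1) ^ 3 + algebraMap (MvPolynomial (Fin 3) k) K (X 2) ^ 4) *
          (algebraMap (MvPolynomial (Fin 3) k) K (X 0))⁻¹} : Set K)) := by
    rw [hgdef, hR]
  refine ⟨((Subalgebra.equivOfEq _ _ hL).symm.toRingEquiv.trans e).trans (Ideal.quotEquivOfEq hJ), fun p hp => ?_⟩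
  have hp' : MvPolynomial.aeval (R := k) g p ∈ loc O (MvPolynomial.aeval (R := k) g).range := by rw [hL]; exact hp
  rw [RingEquiv.trans_apply, RingEquiv.trans_apply]
  have h1 : (Subalgebra.equivOfEq _ _ hL).symm.toRingEquiv ⟨_, hp⟩ = ⟨MvPolynomial.aeval (R := k) g p, hp'⟩ :=
    Subtype.ext rfl
  rw [h1, he p hp', Ideal.quotEquivOfEq_mk]

end KC3

end Summit.ResolutionOfSingularities.ResolutionOfSingularities.Theorems.HomologicalConductor.KC3Upper

end
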